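import Summits.ResolutionOfSingularities.ResolutionOfSingularities.Theorems.MarkedTransferCampaignW46MohWindowShadePSBranch
import Summits.ResolutionOfSingularities.ResolutionOfSingularities.Theorems.MarkedTransferCampaignW46MohWindowShadeTerminationStatement
import HarnessLib

/-!
# [OURS · L1 W4.6] Rung (iii) "Moh window" for the classical pair, SURFACES, POWER-SERIES residuals — the TERMINATION statement
  (one OURS predicate, the series twin of `CampaignW46MohWindowShadeSurfaceMeetsFormalCurve`, and its closer)

Cell `res-hironaka`, LADDER-RESOLUTION rung L (D-0089), slot W4.6 rung (iii) «purely inseparable `z^p = f` with `ord f < 2p`»; seat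
`res-L1-s46-pv-6` (gen 6). Host route MarkedTransfer, `--kind definition --supports stmt-ResolutionOfSingularities-16155 --as helper`.
Sibling of `…MohWindowShadeTerminationStatement.lean` (gen 3, desk #151: the same rung for POLYNOMIAL residuals `F ∈ K[y]`, v2 predicate
`CampaignW46MohWindowShadeSurfaceMeetsFormalCurve`). THIS FILE types the termination half of the classical (order, shade) pair for residual
POWER SERIES `F ∈ K⟦y_j, y_i⟧` — the honest residual part of a purely inseparable surface germ `x^p + F(y)` read in a completed local ring —
on the series states of the power-series port (`…MohWindowShadePSModel`, p540070: `MohWindowShadePS.Series`, `Series.step`,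
`Series.IsEquimultiplePoint`, `IsClean`, `Divides`), and closes it by name from `MohWindowShadePS.Series.exists_formal_pfold_curve_of_walk`
(`…PSBranch`, p545505).

* `CampaignW46MohWindowShadePSSurfaceMeetsFormalCurve p K σ`: along every INFINITE walk `S_{n+1} = Series.step p (c n) (b n) (S n)` of point
  blow-ups of `x^p + F(y_j, y_i)`, `F ∈ K⟦y⟧`, presented in the Hauser–Wagner frame (`b n (c n) = 0`; `b n = 0` when `c n = i`), from a CLEANED
  series with `y^r ∣ F`, every step equimultiple, every state inside the window `p ≤ ord F_n < 2p`, SOME residual series is divisible in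
  `K⟦y⟧` by the `p`-th power of a SMOOTH formal curve germ: `F_n = h^p · W`, `h(0) = 0`, some `∂h/∂y_l(0) ≠ 0`.

VACUITY / STRENGTH SELF-CHECK (typer): NOT trivially true — every polynomial walk of the v2 predicate is a series walk (the series step of a
polynomial state is the polynomial step coefficientwise, `Series.coeff_step_F` with `agree_trunc`), so gen 3's inhabitants of the antecedent
(`…TerminationHolds.antecedent_inhabited`: in-window two-cycles, every `p`) inhabit this one, and the conclusion is not automatic (gen 3's
`not_formalCurveCase_of_small_monomial`). NOT trivially false — closed by name below (`campaignW46MohWindowShadePSSurfaceMeetsFormalCurve_holds`, every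
prime `p`, every field of characteristic `p`, every two-letter `σ`). What is NOT claimed: `|σ| ≥ 3`; walks outside the Hauser–Wagner frame; any bound
on finite walks. Candidates not facts; nothing of H. Hironaka's manuscript [claim: Hironaka2017, status: under-review] is used or asserted; the role
named is the one the predicate REPLACES in regime (iii), it is NOT a statement of the manuscript. AI-written; AI review is weaker than expert review.
Reference for the model: H. Hauser, Bull. AMS 47 (2010) §§F–G [Hauser2010]; frame: [HauserWagner2014, §5].
-/

noncomputable section

set_option linter.dupNamespace false -- mandated namespace of this single-conjunct summit

namespace Summit.ResolutionOfSingularities.ResolutionOfSingularities.Theorems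

open Literature.AlgebraicGeometry.Resolution
open Literature.AlgebraicGeometry.Resolution.Hauser2010
open CampaignW46.MohWindowShadePS

/-- [OURS · L1 W4.6] replaces the role of the termination clause of Th. 16.13, ms. p. 87 l. 25–29 (with Th. 16.6 (2) / Eq. (127), p. 84
l. 10–20), in regime (iii) «purely inseparable, `p ≤ ord F < 2p` at every stage» for the classical pair, SURFACES, residual POWER SERIES, walks
presented in the Hauser–Wagner frame: along every infinite walk `S_{n+1} = Series.step p (c n) (b n) (S n)` of series states (`b n (c n) = 0`,
`b n = 0` when `c n = i`), from a cleaned series with `y^r ∣ F`, every step equimultiple, every state inside the window, at some stage `n` there are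
`h, W ∈ K⟦y⟧` with `h(0) = 0`, some linear coefficient of `h` non-zero, and `F_n = h^p · W` — the residual series is divisible by the `p`-th power
of a smooth formal curve germ (`x^p + F_n` carries a formal curve of `p`-fold points). The series twin of `CampaignW46MohWindowShadeSurfaceMeetsFormalCurve`
(polynomial residuals). NOT a statement of the manuscript. -/
def CampaignW46MohWindowShadePSSurfaceMeetsFormalCurve (p : ℕ) (K : Type*) [Field K] [DecidableEq K] [CharP K p]
    (σ : Type*) [Fintype σ] [DecidableEq σ] : Prop :=
  ∀ (j i : σ), i ≠ j → (∀ l, l = j ∨ l = i) →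
    ∀ (S : ℕ → Series σ K) (c : ℕ → σ) (b : ℕ → σ → K),
      (∀ n, b n (c n) = 0) → (∀ n, c n = i → ∀ l, b n l = 0) →
      (∀ n, S (n + 1) = (S n).step p (c n) (b n)) →
      IsClean p (S 0).F → Divides (S 0).r (S 0).F →
      (∀ n, (S n).IsEquimultiplePoint p (c n) (b n)) →
      (∀ n, (p : ℕ∞) ≤ (S n).F.order ∧ (S n).F.order < (2 * p : ℕ)) →
      ∃ (n : ℕ) (h W : MvPowerSeries σ K), MvPowerSeries.constantCoeff h = 0 ∧
        (∃ l, MvPowerSeries.coeff (Finsupp.single l 1) h ≠ 0) ∧ (S n).F = h ^ p * W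

/-- **[OURS · L1 W4.6] THE SERIES TERMINATION PREDICATE HOLDS** — every prime `p`, every field of characteristic `p`, every two-letter `σ`
(`MohWindowShadePS.Series.exists_formal_pfold_curve_of_walk`, p545505). NOT a statement of the manuscript. [folklore] -/
theorem campaignW46MohWindowShadePSSurfaceMeetsFormalCurve_holds (p : ℕ) [Fact p.Prime] (K : Type*) [Field K] [DecidableEq K] [CharP K p]
    (σ : Type*) [Fintype σ] [DecidableEq σ] : CampaignW46MohWindowShadePSSurfaceMeetsFormalCurve p K σ :=
  fun _ _ hij htwo S c b hb hHW hstep hclean hr heq hwin =>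
    Series.exists_formal_pfold_curve_of_walk p hij htwo S c b hb hHW hstep hclean hr heq hwin

/-- **Polynomial walks are series walks**: the v2 polynomial predicate of gen 3 follows from the series predicate (a polynomial state is a series
state; its polynomial step is the series step coefficientwise). [folklore] -/
theorem campaignW46MohWindowShadeSurfaceMeetsFormalCurve_of_ps (p : ℕ) (K : Type*) [Field K] [DecidableEq K] [CharP K p]
    (σ : Type*) [Fintype σ] [DecidableEq σ] (h : CampaignW46MohWindowShadePSSurfaceMeetsFormalCurve p K σ) :
    CampaignW46MohWindowShadeSurfaceMeetsFormalCurve p K σ := by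
  classical
  intro j i hij htwo s c b hb hHW hstep hclean hr heq hwin
  -- the series walk of the polynomial walk
  let S : ℕ → Series σ K := fun n => ⟨((s n).F : MvPowerSeries σ K), (s n).r⟩
  have hSF : ∀ n, (S n).F = ((s n).F : MvPowerSeries σ K) := fun n => rfl
  have hagree : ∀ n M, Agree M (s n) (S n) := fun n M => ⟨fun e _ => (MvPolynomial.coeff_coe _ _).symm, rfl⟩
  have hnat : ∀ n, ∃ o : ℕ, (S n).F.order = o ∧ p ≤ o ∧ o < 2 * p := by
    intro n
    obtain ⟨o, ho, ho2⟩ := (S n).exists_order_eq_of_lt (hwin n).2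
    refine ⟨o, ho, ?_, ho2⟩
    have h1 : (p : ℕ∞) ≤ (o : ℕ∞) := by
      have := (hwin n).1; rw [show ordZero (s n).F = (S n).F.order from rfl, ho] at this; exact this
    exact_mod_cast h1
  have hstepS : ∀ n, S (n + 1) = (S n).step p (c n) (b n) := by
    intro n
    obtain ⟨o, ho, -, -⟩ := hnat n
    have hA := (hagree n (o + p + 1)).step p (c n) (b n) (hb n) ho (by omega)
    rw [← hstep n] at hA
    have hr' : (S (n + 1)).r = ((S n).step p (c n) (b n)).r := hA.2
    have hF' : (S (n + 1)).F = ((S n).step p (c n) (b n)).F := by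
      ext e
      rw [hSF, MvPolynomial.coeff_coe, hstep n]
      exact ((S n).coeff_step_F (hb n) e (s := s n) fun d _ => (MvPolynomial.coeff_coe _ _).symm).symm
    calc S (n + 1) = ⟨(S (n + 1)).F, (S (n + 1)).r⟩ := rfl
      _ = ⟨((S n).step p (c n) (b n)).F, ((S n).step p (c n) (b n)).r⟩ := by rw [hF', hr']
      _ = (S n).step p (c n) (b n) := rfl
  obtain ⟨n, h', W, hh0, hh1, hF⟩ := h j i hij htwo S c b hb hHW hstepS
    (fun d hd => by rw [hSF, MvPolynomial.coeff_coe, ← hclean, coeff_deletePthPowers, if_pos hd])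
    (fun d hd => hr d (MvPolynomial.mem_support_iff.mpr (by rwa [hSF, MvPolynomial.coeff_coe] at hd)))
    (fun n => ((hagree n (2 * p)).isEquimultiplePoint_iff p (c n) (b n) (hb n) le_rfl).mp (heq n))
    (fun n => hwin n)
  exact ⟨n, h', W, hh0, hh1, by rw [← hSF]; exact hF⟩

end Summit.ResolutionOfSingularities.ResolutionOfSingularities.Theorems

end
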